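import Summits.QuantumFields.BalabanUV.Beta.GAN24.ChainLeibniz

/-!
# `BalabanUV.Beta.GAN24.ChainLeibnizFour` — binder row G-an2-4 ∕ (CONV-C), route R7 «TWO CURRENCIES», step S4 (LEIBNIZ) in the DEMOTED
# currency, companion of `GAN24/ChainLeibniz`: the FOUR-slot local vertex chain `Σ_x Σ_{ijlo} c_{ijlo}·f(x,i)g(x,j)h(x,l)e(x,o)` (the SHAPE of
# AN1 Table T row T1's `ad*_h ad_{h′}` bracket between two unit-sourced legs = four columns)

NOT IN PRINT; OUR PROOF ATTEMPT (prover part P3 of row G-an2-4, fibre∕strip («Woodbury») lineage, gen 25; CRUX TEAM (2), ruling «YM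
REDIRECT TOWARDS THE SUMMIT», 2026-08-21).  HONEST DEPENDENCY (cell records, verbatim): «continuum YM on T⁴ ⇐ BetaPertH ∧ nine spine
estimates (0/9 proved); BetaPertH ⇐ (D1) ∧ (D4) ∧ CAP+tail; G-an2-4 gates asym, D1 and NE2/3/4.»  HONEST FRAMING (cell contract, verbatim):
«discharging `BetaPertH` makes Bałaban's UV stability UNCONDITIONAL — a real constructive-QFT result; it is NOT the continuum limit and NOT
the Clay problem.»  ABSOLUTE RULE: nothing printed is a hypothesis; no `def … : Prop`, no sorry.  [folklore] finite-dimensional algebra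
and Cauchy–Schwarz only (split off `GAN24/ChainLeibniz` for the 400-line limit; see that module's header for the route context).

 * `vtx₄ c f g h e := Σ_x Σ_{ijlo} c i j l o·(f(x,i)·g(x,j)·h(x,l)·e(x,o))`, `cnorm₄ c = ‖c‖₁`;
 * **`vtx₄_leibniz`** (exact four-term telescoping); the DEMOTED bounds with the two sup letters on slots (2,3) ∕ (3,4) ∕ (1,2)
   (**`norm_vtx₄_le₂₃ ∕ _le₃₄ ∕ _le₁₂`**, by the cyclic rotation `vtx₄_rotate`), each from `ChainLeibniz.norm_sum_mul₄_le`;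
 * **`norm_vtx₄_sub_vtx₄_le`**: differenced columns in `ℓ²` (`≤ ε`), `ℓ² ≤ A` on `f, e′`, sup letters `≤ B` on the neighbours
   ⟹ `‖V[f′,g′,h′,e′] − V[f,g,h,e]‖ ≤ 4·‖c‖₁·B²·A·ε` — every term of the Leibniz sum has its differenced slot in `ℓ²`: no sup-norm RATE.

Consumer: `GAN24/SoftColumnVertexRateFour` (the instance on NE2-P1's `U = 1` soft-minimiser tower).  NEVER «G-an2-4 closed»; NOT (CONV-C),
NOT D1, NOT BetaPertH, NOT continuum, NOT Clay.  Provenance: prover-b2b-balaban-gan24-p3-g25-0 (unit `b2b-balaban-gan24-p3`, gen 25), 2026-08-21.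
-/

noncomputable section

open scoped BigOperators ComplexConjugate Matrix Matrix.Norms.L2Operator
open Finset

namespace Summit.QuantumFields.BalabanUV.Beta.GAN24.ChainLeibnizFour

open Literature.MathematicalPhysics.QuantumFieldTheory.Balaban1983to89.B5Prop11Lower (nsq nsq_nonneg)
open Summit.QuantumFields.BalabanUV.Beta.GAN24.ChainLeibniz

/-! ## §2 The four-slot twin (T1's `ad*_h ad_{h′}` shape: leg · column · column · leg) -/

section Vertex4

variable {α κ : Type*} [Fintype α] [Fintype κ]

/-- the `ℓ¹` size of a coefficient tensor with four component slots. [folklore] -/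
def cnorm₄ (c : κ → κ → κ → κ → ℂ) : ℝ := ∑ i, ∑ j, ∑ l, ∑ o, ‖c i j l o‖

omit [Fintype α] in
/-- `0 ≤ ‖c‖₁`. [folklore] -/
theorem cnorm₄_nonneg (c : κ → κ → κ → κ → ℂ) : 0 ≤ cnorm₄ c :=
  Finset.sum_nonneg fun _ _ => Finset.sum_nonneg fun _ _ => Finset.sum_nonneg fun _ _ =>
    Finset.sum_nonneg fun _ _ => norm_nonneg _

/-- **THE FOUR-SLOT LOCAL VERTEX CHAIN** `vtx₄ c f g h e = Σ_x Σ_{ijlo} c i j l o·(f(x,i)·g(x,j)·h(x,l)·e(x,o))`. [folklore] -/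
def vtx₄ (c : κ → κ → κ → κ → ℂ) (f g h e : α × κ → ℂ) : ℂ :=
  ∑ x, ∑ i, ∑ j, ∑ l, ∑ o, c i j l o * (f (x, i) * g (x, j) * h (x, l) * e (x, o))

/-- **LEIBNIZ (exact), four slots**. [folklore] -/
theorem vtx₄_leibniz (c : κ → κ → κ → κ → ℂ) (f g h e f' g' h' e' : α × κ → ℂ) :
    vtx₄ c f' g' h' e' - vtx₄ c f g h e
      = vtx₄ c (f' - f) g' h' e' + vtx₄ c f (g' - g) h' e' + vtx₄ c f g (h' - h) e' + vtx₄ c f g h (e' - e) := by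
  simp only [vtx₄, ← Finset.sum_add_distrib, ← Finset.sum_sub_distrib, Pi.sub_apply]
  refine Finset.sum_congr rfl fun x _ => Finset.sum_congr rfl fun i _ => Finset.sum_congr rfl fun j _ =>
    Finset.sum_congr rfl fun l _ => Finset.sum_congr rfl fun o _ => ?_
  ring

/-- the component-wise reduction for four slots. [folklore] -/
theorem norm_vtx₄_le_of_forall (c : κ → κ → κ → κ → ℂ) (f g h e : α × κ → ℂ) {K : ℝ}
    (hK : ∀ i j l o, ‖∑ x, f (x, i) * g (x, j) * h (x, l) * e (x, o)‖ ≤ K) : ‖vtx₄ c f g h e‖ ≤ cnorm₄ c * K := by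
  have eq : vtx₄ c f g h e = ∑ i, ∑ j, ∑ l, ∑ o, c i j l o * ∑ x, f (x, i) * g (x, j) * h (x, l) * e (x, o) := by
    rw [vtx₄, Finset.sum_comm]
    refine Finset.sum_congr rfl fun i _ => ?_
    rw [Finset.sum_comm]
    refine Finset.sum_congr rfl fun j _ => ?_
    rw [Finset.sum_comm]
    refine Finset.sum_congr rfl fun l _ => ?_
    rw [Finset.sum_comm]
    refine Finset.sum_congr rfl fun o _ => ?_
    rw [Finset.mul_sum]
  rw [eq, cnorm₄, Finset.sum_mul]
  refine (norm_sum_le _ _).trans (Finset.sum_le_sum fun i _ => ?_)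
  rw [Finset.sum_mul]
  refine (norm_sum_le _ _).trans (Finset.sum_le_sum fun j _ => ?_)
  rw [Finset.sum_mul]
  refine (norm_sum_le _ _).trans (Finset.sum_le_sum fun l _ => ?_)
  rw [Finset.sum_mul]
  refine (norm_sum_le _ _).trans (Finset.sum_le_sum fun o _ => ?_)
  rw [norm_mul]
  exact mul_le_mul_of_nonneg_left (hK i j l o) (norm_nonneg _)

/-- **DEMOTED BOUND, sups on slots 2 and 3**: `‖vtx₄ c f g h e‖ ≤ ‖c‖₁·(B_g·B_h·(√(nsq f)·√(nsq e)))`. [folklore] -/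
theorem norm_vtx₄_le₂₃ (c : κ → κ → κ → κ → ℂ) (f g h e : α × κ → ℂ) {Bg Bh : ℝ} (hBg : 0 ≤ Bg) (hBh : 0 ≤ Bh)
    (hg : ∀ z, ‖g z‖ ≤ Bg) (hh : ∀ z, ‖h z‖ ≤ Bh) :
    ‖vtx₄ c f g h e‖ ≤ cnorm₄ c * (Bg * Bh * (Real.sqrt (nsq f) * Real.sqrt (nsq e))) := by
  refine norm_vtx₄_le_of_forall c f g h e fun i j l o => ?_
  calc ‖∑ x, f (x, i) * g (x, j) * h (x, l) * e (x, o)‖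
      ≤ Bg * Bh * (Real.sqrt (∑ x, ‖f (x, i)‖ ^ 2) * Real.sqrt (∑ x, ‖e (x, o)‖ ^ 2)) :=
        norm_sum_mul₄_le (fun x => f (x, i)) (fun x => g (x, j)) (fun x => h (x, l)) (fun x => e (x, o)) hBg hBh
          (fun x => hg (x, j)) fun x => hh (x, l)
    _ ≤ Bg * Bh * (Real.sqrt (nsq f) * Real.sqrt (nsq e)) :=
        mul_le_mul_of_nonneg_left (mul_le_mul (sqrt_slice_le f i) (sqrt_slice_le e o) (Real.sqrt_nonneg _)
          (Real.sqrt_nonneg _)) (mul_nonneg hBg hBh)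

/-- cyclic rotation of the four slots: `vtx₄ c f g h e = vtx₄ c↺ g h e f`, `c↺ j l o i = c i j l o`. [folklore] -/
theorem vtx₄_rotate (c : κ → κ → κ → κ → ℂ) (f g h e : α × κ → ℂ) :
    vtx₄ c f g h e = vtx₄ (fun j l o i => c i j l o) g h e f := by
  simp only [vtx₄]
  refine Finset.sum_congr rfl fun x _ => ?_
  rw [Finset.sum_comm]
  refine Finset.sum_congr rfl fun j _ => ?_
  rw [Finset.sum_comm]
  refine Finset.sum_congr rfl fun l _ => ?_
  rw [Finset.sum_comm]
  refine Finset.sum_congr rfl fun o _ => Finset.sum_congr rfl fun i _ => ?_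
  ring

omit [Fintype α] in
/-- `‖c↺‖₁ = ‖c‖₁`. [folklore] -/
theorem cnorm₄_rotate (c : κ → κ → κ → κ → ℂ) : cnorm₄ (fun j l o i => c i j l o) = cnorm₄ c := by
  rw [cnorm₄, cnorm₄]
  calc ∑ j, ∑ l, ∑ o, ∑ i, ‖c i j l o‖ = ∑ j, ∑ l, ∑ i, ∑ o, ‖c i j l o‖ := by
        refine Finset.sum_congr rfl fun j _ => Finset.sum_congr rfl fun l _ => ?_
        rw [Finset.sum_comm]
    _ = ∑ j, ∑ i, ∑ l, ∑ o, ‖c i j l o‖ := by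
        refine Finset.sum_congr rfl fun j _ => ?_
        rw [Finset.sum_comm]
    _ = ∑ i, ∑ j, ∑ l, ∑ o, ‖c i j l o‖ := by rw [Finset.sum_comm]

/-- **DEMOTED BOUND, sups on slots 3 and 4** (`ℓ²` on 2, 1). [folklore] -/
theorem norm_vtx₄_le₃₄ (c : κ → κ → κ → κ → ℂ) (f g h e : α × κ → ℂ) {Bh Be : ℝ} (hBh : 0 ≤ Bh) (hBe : 0 ≤ Be)
    (hh : ∀ z, ‖h z‖ ≤ Bh) (he : ∀ z, ‖e z‖ ≤ Be) :
    ‖vtx₄ c f g h e‖ ≤ cnorm₄ c * (Bh * Be * (Real.sqrt (nsq g) * Real.sqrt (nsq f))) := by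
  rw [vtx₄_rotate, ← cnorm₄_rotate c]
  exact norm_vtx₄_le₂₃ _ g h e f hBh hBe hh he

/-- **DEMOTED BOUND, sups on slots 1 and 2** (`ℓ²` on 4, 3). [folklore] -/
theorem norm_vtx₄_le₁₂ (c : κ → κ → κ → κ → ℂ) (f g h e : α × κ → ℂ) {Bf Bg : ℝ} (hBf : 0 ≤ Bf) (hBg : 0 ≤ Bg)
    (hf : ∀ z, ‖f z‖ ≤ Bf) (hg : ∀ z, ‖g z‖ ≤ Bg) :
    ‖vtx₄ c f g h e‖ ≤ cnorm₄ c * (Bf * Bg * (Real.sqrt (nsq e) * Real.sqrt (nsq h))) := by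
  rw [vtx₄_rotate, vtx₄_rotate, vtx₄_rotate, ← cnorm₄_rotate c, ← cnorm₄_rotate, ← cnorm₄_rotate]
  exact norm_vtx₄_le₂₃ _ e f g h hBf hBg hf hg

/-- **R7-S4 FOR THE FOUR-SLOT CHAIN**: differenced columns `ℓ² ≤ ε`; `ℓ² ≤ A` on `f` and `e′`; sup letters `≤ B` on the columns used as
NEIGHBOURS (`g′, h′` ∕ `h′, e′` ∕ `f, g` ∕ `g, h`) ⟹ `‖V[f′,g′,h′,e′] − V[f,g,h,e]‖ ≤ 4·‖c‖₁·B²·A·ε`. [folklore] -/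
theorem norm_vtx₄_sub_vtx₄_le (c : κ → κ → κ → κ → ℂ) (f g h e f' g' h' e' : α × κ → ℂ) {ε A B : ℝ} (hε : 0 ≤ ε)
    (hA : 0 ≤ A) (hB : 0 ≤ B)
    (hdf : nsq (f' - f) ≤ ε ^ 2) (hdg : nsq (g' - g) ≤ ε ^ 2) (hdh : nsq (h' - h) ≤ ε ^ 2) (hde : nsq (e' - e) ≤ ε ^ 2)
    (hf : nsq f ≤ A ^ 2) (he' : nsq e' ≤ A ^ 2)
    (hfsup : ∀ z, ‖f z‖ ≤ B) (hgsup : ∀ z, ‖g z‖ ≤ B) (hhsup : ∀ z, ‖h z‖ ≤ B) (hg'sup : ∀ z, ‖g' z‖ ≤ B)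
    (hh'sup : ∀ z, ‖h' z‖ ≤ B) (he'sup : ∀ z, ‖e' z‖ ≤ B) :
    ‖vtx₄ c f' g' h' e' - vtx₄ c f g h e‖ ≤ 4 * (cnorm₄ c * (B * B * (A * ε))) := by
  have hc := cnorm₄_nonneg c
  have hBB : 0 ≤ B * B := mul_nonneg hB hB
  rw [vtx₄_leibniz]
  -- term 1: `(f′−f) g′ h′ e′` — sups on 2,3; ℓ² on `f′−f` (ε) and `e′` (A)
  have t1 : ‖vtx₄ c (f' - f) g' h' e'‖ ≤ cnorm₄ c * (B * B * (A * ε)) := by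
    refine (norm_vtx₄_le₂₃ c _ _ _ _ hB hB hg'sup hh'sup).trans
      (mul_le_mul_of_nonneg_left (mul_le_mul_of_nonneg_left ?_ hBB) hc)
    rw [mul_comm A ε]
    exact mul_le_mul (sqrt_nsq_le_of_sq hε hdf) (sqrt_nsq_le_of_sq hA he') (Real.sqrt_nonneg _) hε
  -- term 2: `f (g′−g) h′ e′` — sups on 3,4; ℓ² on `g′−g` (ε) and `f` (A)
  have t2 : ‖vtx₄ c f (g' - g) h' e'‖ ≤ cnorm₄ c * (B * B * (A * ε)) := by
    refine (norm_vtx₄_le₃₄ c _ _ _ _ hB hB hh'sup he'sup).trans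
      (mul_le_mul_of_nonneg_left (mul_le_mul_of_nonneg_left ?_ hBB) hc)
    rw [mul_comm A ε]
    exact mul_le_mul (sqrt_nsq_le_of_sq hε hdg) (sqrt_nsq_le_of_sq hA hf) (Real.sqrt_nonneg _) hε
  -- term 3: `f g (h′−h) e′` — sups on 1,2; ℓ² on `e′` (A) and `h′−h` (ε)
  have t3 : ‖vtx₄ c f g (h' - h) e'‖ ≤ cnorm₄ c * (B * B * (A * ε)) := by
    refine (norm_vtx₄_le₁₂ c _ _ _ _ hB hB hfsup hgsup).trans
      (mul_le_mul_of_nonneg_left (mul_le_mul_of_nonneg_left ?_ hBB) hc)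
    exact mul_le_mul (sqrt_nsq_le_of_sq hA he') (sqrt_nsq_le_of_sq hε hdh) (Real.sqrt_nonneg _) hA
  -- term 4: `f g h (e′−e)` — sups on 2,3; ℓ² on `f` (A) and `e′−e` (ε)
  have t4 : ‖vtx₄ c f g h (e' - e)‖ ≤ cnorm₄ c * (B * B * (A * ε)) := by
    refine (norm_vtx₄_le₂₃ c _ _ _ _ hB hB hgsup hhsup).trans
      (mul_le_mul_of_nonneg_left (mul_le_mul_of_nonneg_left ?_ hBB) hc)
    exact mul_le_mul (sqrt_nsq_le_of_sq hA hf) (sqrt_nsq_le_of_sq hε hde) (Real.sqrt_nonneg _) hA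
  calc _ ≤ ‖vtx₄ c (f' - f) g' h' e' + vtx₄ c f (g' - g) h' e' + vtx₄ c f g (h' - h) e'‖ + ‖vtx₄ c f g h (e' - e)‖ :=
        norm_add_le _ _
    _ ≤ ‖vtx₄ c (f' - f) g' h' e' + vtx₄ c f (g' - g) h' e'‖ + ‖vtx₄ c f g (h' - h) e'‖ + ‖vtx₄ c f g h (e' - e)‖ := by
        gcongr; exact norm_add_le _ _
    _ ≤ ‖vtx₄ c (f' - f) g' h' e'‖ + ‖vtx₄ c f (g' - g) h' e'‖ + ‖vtx₄ c f g (h' - h) e'‖ + ‖vtx₄ c f g h (e' - e)‖ := by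
        gcongr; exact norm_add_le _ _
    _ ≤ cnorm₄ c * (B * B * (A * ε)) + cnorm₄ c * (B * B * (A * ε)) + cnorm₄ c * (B * B * (A * ε))
          + cnorm₄ c * (B * B * (A * ε)) := add_le_add (add_le_add (add_le_add t1 t2) t3) t4
    _ = 4 * (cnorm₄ c * (B * B * (A * ε))) := by ring

end Vertex4


end Summit.QuantumFields.BalabanUV.Beta.GAN24.ChainLeibnizFour

end
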